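import Summits.BirchSwinnertonDyer.BirchSwinnertonDyer.Theses.SylvesterTwoHeegnerIndex
import HarnessLib

/-!
# Route `SylvesterTwoHeegnerIndex` (rung K7t): the deciding bridge for the GZK-CONDITIONAL twins of
# the two cruxes (repair path D75-style for items 19229 / 19230)

HONEST FRAMING (cell «bsd-cm», seat `bsd-cm-k7t-c3`): nothing is asserted; the class 𝒞_HSY at `p = 2`
(B14 / O12) stays OPEN; no label moves. Both cruxes of the route, `HeegnerIndexLowerAtTwoHSY` (19230)
and `HeegnerIndexUpperAtTwoHSY` (19229), are fact-free as filed, while their conclusions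
(`padicValNat 2 (Nat.card W.sha)`, a Heegner index) are meaningful only with `Finite Ш(E_p)` and
`rank E_p(ℚ) = 1` — i.e. behind GZK (`rank_eq_analyticRank_of_analyticRank_le_one`, the 8th conjunct
of the route's support item `PublishedFactsTwo`, 19231). The cell's precedent for such a statement
defect is ruling D75 (K7r `FrameDataSevenOfGZK := GZK → FrameDataSeven`). This file supplies, ahead of
the planner's restatement, the ONE-LINE deciding bridges the restated route needs, so that its
`closes` elaborates by name:

* `cmAtTwo_of_halvesOfGZK : (GZK → Lower) → (GZK → Upper) → PublishedFactsTwo → X12.CMAtTwo`;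
* `cmAtTwo_of_halvesOfFacts : (PublishedFactsTwo → Lower) → (PublishedFactsTwo → Upper) →
  PublishedFactsTwo → X12.CMAtTwo` (the weakest twins that still close the leaf).

Both are `CMRungInputs.cmAtTwo_of_inputs` (p406906) fed with the GZK conjunct of the facts. A twin
item `HeegnerIndexLowerAtTwoHSYOfGZK := rank_eq_analyticRank_of_analyticRank_le_one → <body of 19230
verbatim>` unfolds definitionally to the first hypothesis below.
[cite: Miller2011LMS, Def. 1.1] [cite: GrossZagier1986, V.§2 (pp. 310–312)] [cite: HuShuYin2019, Thm. 1.3 and Thm. 1.4 (p. 3)]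
-/

set_option autoImplicit false
set_option linter.dupNamespace false

open Literature.NumberTheory.EllipticCurves
  Summit.BirchSwinnertonDyer.BirchSwinnertonDyer.Theses.SylvesterTwoHeegnerIndex

namespace Summit.BirchSwinnertonDyer.BirchSwinnertonDyer.Theorems.SylvesterTwoLower

/-- **Deciding bridge for the GZK-conditional twins.** If the lower and upper halves of the `2`-adic
Heegner-index identity on 𝒞_HSY hold GRANTED GZK, then the published facts give the rung leaf
`X12.CMAtTwo` (`BSD(E_p, 2)` on 𝒞_HSY): GZK is the 8th conjunct of `PublishedFactsTwo`.
[cite: Miller2011LMS, Def. 1.1] [cite: GrossZagier1986, V.§2 (pp. 310–312)] -/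
theorem cmAtTwo_of_halvesOfGZK
    (hlo : rank_eq_analyticRank_of_analyticRank_le_one → HeegnerIndexLowerAtTwoHSY)
    (hup : rank_eq_analyticRank_of_analyticRank_le_one → HeegnerIndexUpperAtTwoHSY)
    (hF : PublishedFactsTwo) : Summit.BirchSwinnertonDyer.Rank1Residual.X12.CMAtTwo :=
  Summit.BirchSwinnertonDyer.BirchSwinnertonDyer.Rank1Residual.CMRungInputs.cmAtTwo_of_inputs
    (hlo hF.2.2.2.2.2.2.2.1) (hup hF.2.2.2.2.2.2.2.1) hF

/-- **Deciding bridge for the facts-conditional twins** (the weakest restatement that still closes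
the leaf): halves granted `PublishedFactsTwo`, plus `PublishedFactsTwo`, give `X12.CMAtTwo`.
[cite: Miller2011LMS, Def. 1.1] [cite: HuShuYin2019, Thm. 1.3 and Thm. 1.4 (p. 3)] -/
theorem cmAtTwo_of_halvesOfFacts
    (hlo : PublishedFactsTwo → HeegnerIndexLowerAtTwoHSY)
    (hup : PublishedFactsTwo → HeegnerIndexUpperAtTwoHSY)
    (hF : PublishedFactsTwo) : Summit.BirchSwinnertonDyer.Rank1Residual.X12.CMAtTwo :=
  Summit.BirchSwinnertonDyer.BirchSwinnertonDyer.Rank1Residual.CMRungInputs.cmAtTwo_of_inputs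
    (hlo hF) (hup hF) hF

/-- The GZK-conditional lower half follows from the facts-free crux (trivially) — so the twin item
is WEAKER than 19230 and anything landed `--supports 19230` serves it. Bookkeeping. [folklore] -/
theorem lowerOfGZK_of_lower (h : HeegnerIndexLowerAtTwoHSY) :
    rank_eq_analyticRank_of_analyticRank_le_one → HeegnerIndexLowerAtTwoHSY := fun _ => h

/-- Likewise for the upper half. Bookkeeping. [folklore] -/
theorem upperOfGZK_of_upper (h : HeegnerIndexUpperAtTwoHSY) :
    rank_eq_analyticRank_of_analyticRank_le_one → HeegnerIndexUpperAtTwoHSY := fun _ => h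

end Summit.BirchSwinnertonDyer.BirchSwinnertonDyer.Theorems.SylvesterTwoLower
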